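import Mathlib.RingTheory.Ideal.Operations
import Mathlib.Algebra.BigOperators.Ring.Finset
import Mathlib.Algebra.BigOperators.Pi
import Mathlib.Tactic.LinearCombination
import Mathlib.Tactic.Ring
import HarnessLib

/-!
# Preliminaries for the leading-term lemma: slices of a product group and ideal-power bookkeeping

Cell `b2b-bsdres`, team n1011, seat p09 GEN 3, OWNERS row T-TW3 (rider of ROUTE-1 §19.6 R1-18), FILE 4a;
used by `KuriharaTwistIdentity.lean` (FILE 4) and `KuriharaTwistIdentityBins.lean` (FILE 5).
Namespace `Summit.BirchSwinnertonDyer.Rank1Residual.Supersingular.KuriharaTwist.Identity`.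

HONEST FRAMING (run/shared/lean/b2b/bsd-rank1-residual/, verbatim in every file): the goal of the
cell is to DELETE the COMBINATION-SHAPED residual classes of the Birch–Swinnerton-Dyer formula for
ALL analytic-rank `≤ 1` elliptic curves over `ℚ` — "full BSD formula for every rank `≤ 1` curve in
class `C`" assembled STRICTLY from published theorems — so that the rank-`≤ 1` remainder becomes
exactly the CONSTRUCTION-SHAPED classes, which are TYPED (missing-input `Prop`s), NOT attempted.
This is not "finishing BSD".  Team n1011 is a RESEARCH ROUTE; this file is a TOOL THEOREM of
elementary algebra (no named fact, no elliptic curve, nothing booked; marks unchanged).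


## Contents

* `slice U` — the elements of `Π_i G_i` with trivial coordinates outside `U`; `proj U g`;
  `sum_slice_mul_left` (translation-invariance of sums over a slice), `sum_slice_eq_sum_erase_update`
  (`slice U ≃ slice (U∖i) × G_i`).
* `prod_mem_pow_card` (`Π` of `|s|` elements of `J` lies in `J^|s|`), `prod_sub_one_mem`
  (`Π u_a − 1 ∈ J` when all `u_a ≡ 1`), `add_inv_sub_two_mem_sq` (`t + t⁻¹ − 2 = t⁻¹(t−1)² ∈ J²`),
  `prod_sub_pow_mul_prod_mem` (`a_i ≡ b_i·y (mod J²)`, `y ∈ J` ⟹ `Π a_i ≡ y^n Π b_i (mod J^{n+1})`).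

Elementary algebra; no elliptic curve; nothing booked.
-/

open Finset

namespace Summit.BirchSwinnertonDyer.Rank1Residual.Supersingular.KuriharaTwist.Identity

variable {ι : Type*} [Fintype ι] [DecidableEq ι]
variable {G : ι → Type*} [∀ i, CommGroup (G i)] [∀ i, Fintype (G i)] [∀ i, DecidableEq (G i)]
variable {B : Type*} [CommRing B]

/-- The level-`U` slice of the product group: coordinates outside `U` are trivial. [folklore] -/
def slice (U : Finset ι) : Finset (Π i, G i) := univ.filter fun a => ∀ i, i ∉ U → a i = 1

/-- Membership in a slice. [folklore] -/
theorem mem_slice {U : Finset ι} {a : Π i, G i} : a ∈ slice U ↔ ∀ i, i ∉ U → a i = 1 := by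
  simp [slice]

/-- Projection of an element onto the slice subgroup of `U`. [folklore] -/
def proj (U : Finset ι) (g : Π i, G i) : Π i, G i := fun i => if i ∈ U then g i else 1

omit [Fintype ι] [∀ i, Fintype (G i)] [∀ i, DecidableEq (G i)] in
/-- `proj` keeps the coordinates in `U`. [folklore] -/
@[simp] theorem proj_apply_of_mem {U : Finset ι} {g : Π i, G i} {i : ι} (h : i ∈ U) :
    proj U g i = g i := by simp [proj, h]

omit [Fintype ι] [∀ i, Fintype (G i)] [∀ i, DecidableEq (G i)] in
/-- `proj` kills the coordinates outside `U`. [folklore] -/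
@[simp] theorem proj_apply_of_not_mem {U : Finset ι} {g : Π i, G i} {i : ι} (h : i ∉ U) :
    proj U g i = 1 := by simp [proj, h]

/-- Slices are closed under multiplication. [folklore] -/
theorem mul_mem_slice {U : Finset ι} {g a : Π i, G i} (hg : g ∈ slice U) (ha : a ∈ slice U) :
    g * a ∈ slice U := by
  rw [mem_slice] at *
  intro i hi
  simp [Pi.mul_apply, hg i hi, ha i hi]

/-- `proj U g` lies in the slice of `U`. [folklore] -/
theorem proj_mem_slice (U : Finset ι) (g : Π i, G i) : proj U g ∈ slice U := by
  rw [mem_slice]; intro i hi; simp [proj, hi]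

/-- Translating the slice by an element of the slice is a bijection: reindex a sum. [folklore] -/
theorem sum_slice_mul_left (U : Finset ι) {g : Π i, G i} (hg : g ∈ slice U) (F : (Π i, G i) → B) :
    ∑ a ∈ slice U, F (g * a) = ∑ a ∈ slice U, F a := by
  refine Finset.sum_nbij' (fun a => g * a) (fun a => g⁻¹ * a) ?_ ?_ ?_ ?_ ?_
  · intro a ha; exact mul_mem_slice hg ha
  · intro a ha
    have : g⁻¹ ∈ slice U := by
      rw [mem_slice] at hg ⊢; intro i hi; simp [hg i hi]
    exact mul_mem_slice this ha
  · intro a _; simp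
  · intro a _; simp
  · intro a _; rfl

/-- Splitting a sum over `slice U` at a coordinate `i ∈ U`: `slice U ≃ slice (U.erase i) × G i` via
`(c, b) ↦ update c i b`. [folklore] -/
theorem sum_slice_eq_sum_erase_update {U : Finset ι} {i : ι} (hi : i ∈ U) (F : (Π i, G i) → B) :
    ∑ a ∈ slice U, F a = ∑ c ∈ slice (U.erase i), ∑ b : G i, F (Function.update c i b) := by
  classical
  rw [← Finset.sum_product' (s := slice (U.erase i)) (t := (univ : Finset (G i)))
    (f := fun c b => F (Function.update c i b))]
  symm
  refine Finset.sum_nbij' (fun cb => Function.update cb.1 i cb.2) (fun a => (Function.update a i 1, a i))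
    ?_ ?_ ?_ ?_ ?_
  · rintro ⟨c, b⟩ hcb
    rw [Finset.mem_product] at hcb
    rw [mem_slice] at hcb ⊢
    intro j hj
    have hji : j ≠ i := fun h => hj (h ▸ hi)
    rw [Function.update_of_ne hji]
    exact hcb.1 j (fun h => hj (Finset.mem_of_mem_erase h))
  · intro a ha
    rw [Finset.mem_product, mem_slice]
    refine ⟨fun j hj => ?_, Finset.mem_univ _⟩
    by_cases hji : j = i
    · subst hji; simp
    · show Function.update a i 1 j = 1
      rw [Function.update_of_ne hji]
      rw [mem_slice] at ha
      exact ha j (fun h => hj (Finset.mem_erase.2 ⟨hji, h⟩))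
  · rintro ⟨c, b⟩ hcb
    rw [Finset.mem_product, mem_slice] at hcb
    refine Prod.ext ?_ ?_
    · funext j
      by_cases hji : j = i
      · subst hji; have := hcb.1 j (Finset.notMem_erase j U); simp only [Function.update_self] at this ⊢; exact this.symm
      · simp [Function.update_of_ne hji]
    · simp
  · intro a _
    simp only
    funext j
    by_cases hji : j = i
    · subst hji; simp
    · simp [Function.update_of_ne hji]
  · intro cb _; rfl



section IdealPow

variable {B : Type*} [CommRing B] (J : Ideal B)

/-- A product of `card s` elements of `J` lies in `J ^ card s`. [folklore] -/
theorem prod_mem_pow_card {α : Type*} [DecidableEq α] (s : Finset α) (f : α → B)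
    (h : ∀ a ∈ s, f a ∈ J) : ∏ a ∈ s, f a ∈ J ^ s.card := by
  induction s using Finset.induction_on with
  | empty => simp
  | insert a s ha ih =>
    rw [Finset.prod_insert ha, Finset.card_insert_of_notMem ha, pow_succ']
    exact Ideal.mul_mem_mul (h a (Finset.mem_insert_self a s))
      (ih fun b hb => h b (Finset.mem_insert_of_mem hb))

/-- `∏ u_a − 1 ∈ J` when every `u_a − 1 ∈ J`. [folklore] -/
theorem prod_sub_one_mem {α : Type*} [DecidableEq α] (s : Finset α) (u : α → B)
    (h : ∀ a ∈ s, u a - 1 ∈ J) : ∏ a ∈ s, u a - 1 ∈ J := by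
  induction s using Finset.induction_on with
  | empty => simp
  | insert a s ha ih =>
    rw [Finset.prod_insert ha]
    have e : u a * ∏ x ∈ s, u x - 1 = (u a - 1) * ∏ x ∈ s, u x + (∏ x ∈ s, u x - 1) := by ring
    rw [e]
    exact J.add_mem (J.mul_mem_right _ (h a (Finset.mem_insert_self a s)))
      (ih fun b hb => h b (Finset.mem_insert_of_mem hb))

/-- `t + t⁻¹ − 2 = t⁻¹ (t − 1)² ∈ J²` for a unit `t ≡ 1 (mod J)`. [folklore] -/
theorem add_inv_sub_two_mem_sq (t : Bˣ) (h : (t : B) - 1 ∈ J) :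
    (t : B) + ((t⁻¹ : Bˣ) : B) - 2 ∈ J ^ 2 := by
  have e : (t : B) + ((t⁻¹ : Bˣ) : B) - 2 = ((t⁻¹ : Bˣ) : B) * (((t : B) - 1) * ((t : B) - 1)) := by
    have ht : ((t⁻¹ : Bˣ) : B) * (t : B) = 1 := by simp
    linear_combination (-(t : B) + 2) * ht
  rw [e, pow_two]
  exact Ideal.mul_mem_left _ _ (Ideal.mul_mem_mul h h)

/-- Product congruence: `a_i ≡ b_i·y (mod J²)` with `y ∈ J` gives `∏ a_i ≡ y^n·∏ b_i (mod J^{n+1})`. [folklore] -/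
theorem prod_sub_pow_mul_prod_mem {α : Type*} [DecidableEq α] (s : Finset α) (a b : α → B) (y : B)
    (hy : y ∈ J) (h : ∀ i ∈ s, a i - b i * y ∈ J ^ 2) :
    ∏ i ∈ s, a i - y ^ s.card * ∏ i ∈ s, b i ∈ J ^ (s.card + 1) := by
  induction s using Finset.induction_on with
  | empty => simp
  | insert i s hi ih =>
    rw [Finset.prod_insert hi, Finset.prod_insert hi, Finset.card_insert_of_notMem hi]
    have ih' := ih fun j hj => h j (Finset.mem_insert_of_mem hj)
    have hi' := h i (Finset.mem_insert_self i s)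
    -- a_i * P − y^{n+1} b_i Q = (a_i − b_i y) * P + b_i y * (P − y^n Q)
    have e : a i * ∏ x ∈ s, a x - y ^ (s.card + 1) * (b i * ∏ x ∈ s, b x) =
        (a i - b i * y) * ∏ x ∈ s, a x + b i * y * (∏ x ∈ s, a x - y ^ s.card * ∏ x ∈ s, b x) := by ring
    rw [e]
    refine Ideal.add_mem _ ?_ ?_
    · -- (a_i − b_i y) ∈ J², P ∈ J^n  (each a_j ∈ J: a_j = (a_j − b_j y) + b_j y)
      have hP : ∏ x ∈ s, a x ∈ J ^ s.card := prod_mem_pow_card J s a fun j hj => by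
        have h2 : a j - b j * y ∈ J := Ideal.pow_le_self two_ne_zero (h j (Finset.mem_insert_of_mem hj))
        have : a j = (a j - b j * y) + b j * y := by ring
        rw [this]; exact J.add_mem h2 (J.mul_mem_left _ hy)
      have := Ideal.mul_mem_mul hi' hP
      rw [← pow_add] at this
      exact Ideal.pow_le_pow_right (by omega) this
    · have := Ideal.mul_mem_mul (J.mul_mem_left (b i) hy) ih'
      rw [← pow_succ'] at this
      exact this

end IdealPow

end Summit.BirchSwinnertonDyer.Rank1Residual.Supersingular.KuriharaTwist.Identity
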